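import Mathlib

/-!
# Pairing lemma — group-theoretic core of the transposition-free type-I sieve

Solo study `solo-HodgeConjecture-blind`, session s42 (work/s42/type1-imprimitive.md §7).

Let `H ≤ Perm α` be generated by a set `S` of local monodromies each of which is the identity,
a transposition, a 3-cycle or a double transposition (the generic strata of codimension ≤ 2 of a
dual variety), and let `r` be an `H`-invariant equivalence relation on `α` (a block system).
We prove the elementary facts behind the PAIRING THEOREM:

* `keepsClass`/`closure_keeps_class`: if every generator keeps each point inside its class, so does
  the generated group; with a transitive group the relation is then total
  (`rel_all_of_generators_keep_class`).
* `transp_keeps_class`, `threeCycle_keeps_class`: transpositions and 3-cycles never move a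
  non-singleton class to another class.
* `doubleTransp_moves_class`: a double transposition `(a b)(c d)` that moves the class of `a`
  forces `class(a) ⊆ {a, c}` or `class(a) ⊆ {a, d}` — blocks have size at most two.
* `pairing`: hence, for a transitive group generated by such elements and a non-trivial invariant
  equivalence relation with a non-singleton class, some generator is a double transposition moving
  a class, and that class is a pair.

Everything is elementary and self-contained (no classification of permutation groups is used).
The bridging lemmas `isTranspOn_iff`, `IsTranspOn.isSwap`, `isThreeCycleOn_iff` connect the
pointwise predicates to Mathlib's `Equiv.swap` / `Equiv.Perm.IsSwap` vocabulary.
-/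

namespace Summit.HodgeConjecture.HodgeConjecture.Theorems.Pairing

open Equiv

variable {α : Type*}

/-- `g` is the transposition of the two distinct points `a, b` (pointwise description). -/
def IsTranspOn (g : Perm α) (a b : α) : Prop :=
  a ≠ b ∧ g a = b ∧ g b = a ∧ ∀ x, x ≠ a → x ≠ b → g x = x

/-- `g` is the 3-cycle `a ↦ b ↦ c ↦ a` (pointwise description). -/
def IsThreeCycleOn (g : Perm α) (a b c : α) : Prop :=
  a ≠ b ∧ a ≠ c ∧ b ≠ c ∧ g a = b ∧ g b = c ∧ g c = a ∧
    ∀ x, x ≠ a → x ≠ b → x ≠ c → g x = x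

/-- `g` is the double transposition `(a b)(c d)` on four distinct points (pointwise description). -/
def IsDoubleTranspOn (g : Perm α) (a b c d : α) : Prop :=
  a ≠ b ∧ a ≠ c ∧ a ≠ d ∧ b ≠ c ∧ b ≠ d ∧ c ≠ d ∧
    g a = b ∧ g b = a ∧ g c = d ∧ g d = c ∧
    ∀ x, x ≠ a → x ≠ b → x ≠ c → x ≠ d → g x = x

/-- Bridge to Mathlib: `IsTranspOn g a b` says exactly that `a ≠ b` and `g = Equiv.swap a b`
(so `g.IsSwap`). -/
theorem isTranspOn_iff {g : Perm α} {a b : α} [DecidableEq α] :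
    IsTranspOn g a b ↔ a ≠ b ∧ g = swap a b := by
  constructor
  · rintro ⟨hab, hga, hgb, hfix⟩
    refine ⟨hab, Equiv.ext fun x => ?_⟩
    by_cases hxa : x = a
    · subst hxa; simp [swap_apply_left, hga]
    by_cases hxb : x = b
    · subst hxb; simp [swap_apply_right, hgb]
    rw [swap_apply_of_ne_of_ne hxa hxb, hfix x hxa hxb]
  · rintro ⟨hab, rfl⟩
    refine ⟨hab, swap_apply_left a b, swap_apply_right a b, fun x hxa hxb => ?_⟩
    exact swap_apply_of_ne_of_ne hxa hxb

/-- A pointwise transposition is a swap in Mathlib's sense. -/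
theorem IsTranspOn.isSwap {g : Perm α} {a b : α} [DecidableEq α] (hg : IsTranspOn g a b) :
    g.IsSwap := by
  obtain ⟨hab, rfl⟩ := isTranspOn_iff.mp hg
  exact ⟨a, b, hab, rfl⟩

/-- Bridge to Mathlib: `IsThreeCycleOn g a b c` says exactly that `a, b, c` are pairwise distinct
and `g = swap a c * swap a b` (the 3-cycle `a ↦ b ↦ c ↦ a`). -/
theorem isThreeCycleOn_iff {g : Perm α} {a b c : α} [DecidableEq α] :
    IsThreeCycleOn g a b c ↔ a ≠ b ∧ a ≠ c ∧ b ≠ c ∧ g = swap a c * swap a b := by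
  constructor
  · rintro ⟨hab, hac, hbc, hga, hgb, hgc, hfix⟩
    refine ⟨hab, hac, hbc, Equiv.ext fun x => ?_⟩
    rw [Perm.mul_apply]
    by_cases hxa : x = a
    · subst hxa
      rw [hga, swap_apply_left, swap_apply_of_ne_of_ne (Ne.symm hab) hbc]
    by_cases hxb : x = b
    · subst hxb
      rw [hgb, swap_apply_right, swap_apply_left]
    by_cases hxc : x = c
    · subst hxc
      rw [hgc, swap_apply_of_ne_of_ne (Ne.symm hac) (Ne.symm hbc), swap_apply_right]
    rw [hfix x hxa hxb hxc, swap_apply_of_ne_of_ne hxa hxb, swap_apply_of_ne_of_ne hxa hxc]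
  · rintro ⟨hab, hac, hbc, rfl⟩
    refine ⟨hab, hac, hbc, ?_, ?_, ?_, fun x hxa hxb hxc => ?_⟩
    · rw [Perm.mul_apply, swap_apply_left, swap_apply_of_ne_of_ne (Ne.symm hab) hbc]
    · rw [Perm.mul_apply, swap_apply_right, swap_apply_left]
    · rw [Perm.mul_apply, swap_apply_of_ne_of_ne (Ne.symm hac) (Ne.symm hbc), swap_apply_right]
    · rw [Perm.mul_apply, swap_apply_of_ne_of_ne hxa hxb, swap_apply_of_ne_of_ne hxa hxc]

/-- The permutations keeping every point inside its `r`-class form a subgroup. -/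
def keepsClass (r : α → α → Prop) (hr : Equivalence r) : Subgroup (Perm α) where
  carrier := {h | ∀ x, r x (h x)}
  mul_mem' := by
    intro g h hg hh
    simp only [Set.mem_setOf_eq] at hg hh ⊢
    intro x
    rw [Perm.mul_apply]
    exact hr.trans (hh x) (hg (h x))
  one_mem' := by
    simp only [Set.mem_setOf_eq]
    intro x
    simpa using hr.refl x
  inv_mem' := by
    intro h hh
    simp only [Set.mem_setOf_eq] at hh ⊢
    intro x
    have h1 : r (h⁻¹ x) (h (h⁻¹ x)) := hh (h⁻¹ x)
    rw [show h (h⁻¹ x) = x from h.apply_symm_apply x] at h1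
    exact hr.symm h1

/-- The permutations preserving the relation `r` form a subgroup. -/
def preserves (r : α → α → Prop) : Subgroup (Perm α) where
  carrier := {h | ∀ x y, r (h x) (h y) ↔ r x y}
  mul_mem' := by
    intro g h hg hh
    simp only [Set.mem_setOf_eq] at hg hh ⊢
    intro x y
    rw [Perm.mul_apply, Perm.mul_apply, hg, hh]
  one_mem' := by
    simp only [Set.mem_setOf_eq]
    intro x y
    simp
  inv_mem' := by
    intro h hh
    simp only [Set.mem_setOf_eq] at hh ⊢
    intro x y
    have h1 := hh (h⁻¹ x) (h⁻¹ y)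
    rw [show h (h⁻¹ x) = x from h.apply_symm_apply x,
      show h (h⁻¹ y) = y from h.apply_symm_apply y] at h1
    exact h1.symm

/-- (L4) If every generator keeps points inside their classes, so does every element of the
generated group. -/
theorem closure_keeps_class {r : α → α → Prop} (hr : Equivalence r) {S : Set (Perm α)}
    (hS : ∀ s ∈ S, ∀ x, r x (s x)) {h : Perm α} (hh : h ∈ Subgroup.closure S) (x : α) :
    r x (h x) := by
  have hle : Subgroup.closure S ≤ keepsClass r hr := by
    rw [Subgroup.closure_le]
    intro s hs
    exact hS s hs
  have h' : ∀ y, r y (h y) := hle hh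
  exact h' x

/-- Invariance of `r` under the generators extends to the generated group. -/
theorem closure_preserves {r : α → α → Prop} {S : Set (Perm α)}
    (hS : ∀ s ∈ S, ∀ x y, r (s x) (s y) ↔ r x y) {h : Perm α}
    (hh : h ∈ Subgroup.closure S) (x y : α) : r (h x) (h y) ↔ r x y := by
  have hle : Subgroup.closure S ≤ preserves r := by
    rw [Subgroup.closure_le]
    intro s hs
    exact hS s hs
  have h' : ∀ u v, r (h u) (h v) ↔ r u v := hle hh
  exact h' x y

/-- (L4′) With a transitive generated group, generators keeping classes force the relation to be
total: for every non-trivial block system some generator moves blocks. -/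
theorem rel_all_of_generators_keep_class {r : α → α → Prop} (hr : Equivalence r)
    {S : Set (Perm α)} (hS : ∀ s ∈ S, ∀ x, r x (s x))
    (htrans : ∀ x y : α, ∃ h ∈ Subgroup.closure S, h x = y) (x y : α) : r x y := by
  obtain ⟨h, hh, hxy⟩ := htrans x y
  rw [← hxy]
  exact closure_keeps_class hr hS hh x

/-- (L1) A transposition preserving `r` keeps a non-singleton class: it never moves blocks. -/
theorem transp_keeps_class {r : α → α → Prop} (hr : Equivalence r) {g : Perm α} {a b : α}
    (hg : IsTranspOn g a b) (hinv : ∀ x y, r (g x) (g y) ↔ r x y)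
    (hna : ∃ x, x ≠ a ∧ r a x) : r a b := by
  obtain ⟨_, hga, _, hfix⟩ := hg
  obtain ⟨x, hxa, hax⟩ := hna
  by_cases hxb : x = b
  · rw [hxb] at hax
    exact hax
  · have h1 := (hinv a x).2 hax
    rw [hga, hfix x hxa hxb] at h1
    exact hr.trans hax (hr.symm h1)

/-- (L2) A 3-cycle preserving `r` keeps a non-singleton class: it never moves blocks. -/
theorem threeCycle_keeps_class {r : α → α → Prop} (hr : Equivalence r) {g : Perm α}
    {a b c : α} (hg : IsThreeCycleOn g a b c) (hinv : ∀ x y, r (g x) (g y) ↔ r x y)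
    (hna : ∃ x, x ≠ a ∧ r a x) : r a b := by
  obtain ⟨_, _, _, hga, _, hgc, hfix⟩ := hg
  obtain ⟨x, hxa, hax⟩ := hna
  by_cases hxb : x = b
  · rw [hxb] at hax
    exact hax
  by_cases hxc : x = c
  · rw [hxc] at hax
    have h1 := (hinv a c).2 hax
    rw [hga, hgc] at h1
    exact hr.symm h1
  · have h1 := (hinv a x).2 hax
    rw [hga, hfix x hxa hxb hxc] at h1
    exact hr.trans hax (hr.symm h1)

/-- (L3) A double transposition `(a b)(c d)` preserving `r` that moves the class of `a`
(`¬ r a b`) confines that class to `{a, c, d}`, and not both `c, d` lie in it. -/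
theorem doubleTransp_moves_class {r : α → α → Prop} (hr : Equivalence r) {g : Perm α}
    {a b c d : α} (hg : IsDoubleTranspOn g a b c d)
    (hinv : ∀ x y, r (g x) (g y) ↔ r x y) (hmove : ¬ r a b) :
    (∀ x, r a x → x = a ∨ x = c ∨ x = d) ∧ ¬ (r a c ∧ r a d) := by
  obtain ⟨_, _, _, _, _, _, hga, _, hgc, _, hfix⟩ := hg
  refine ⟨fun x hax => ?_, fun hcd => ?_⟩
  · by_contra hx
    simp only [not_or] at hx
    obtain ⟨hxa, hxc, hxd⟩ := hx
    by_cases hxb : x = b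
    · rw [hxb] at hax
      exact hmove hax
    · have h1 := (hinv a x).2 hax
      rw [hga, hfix x hxa hxb hxc hxd] at h1
      exact hmove (hr.trans hax (hr.symm h1))
  · obtain ⟨hac, had⟩ := hcd
    have h1 := (hinv a c).2 hac
    rw [hga, hgc] at h1
    exact hmove (hr.trans had (hr.symm h1))

/-- (L3′) In the situation of `doubleTransp_moves_class` the class of `a` is contained in the pair
`{a, c}` or in the pair `{a, d}`: blocks have size at most two. -/
theorem doubleTransp_class_pair {r : α → α → Prop} (hr : Equivalence r) {g : Perm α}
    {a b c d : α} (hg : IsDoubleTranspOn g a b c d)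
    (hinv : ∀ x y, r (g x) (g y) ↔ r x y) (hmove : ¬ r a b) :
    (∀ x, r a x → x = a ∨ x = c) ∨ (∀ x, r a x → x = a ∨ x = d) := by
  obtain ⟨h3, hnot⟩ := doubleTransp_moves_class hr hg hinv hmove
  by_cases hc : r a c
  · left
    intro x hx
    rcases h3 x hx with h | h | h
    · exact Or.inl h
    · exact Or.inr h
    · rw [h] at hx
      exact (hnot ⟨hc, hx⟩).elim
  · right
    intro x hx
    rcases h3 x hx with h | h | h
    · exact Or.inl h
    · rw [h] at hx
      exact (hc hx).elim
    · exact Or.inr h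

/-- Relabelling a transposition. -/
theorem IsTranspOn.swap_args {g : Perm α} {a b : α} (hg : IsTranspOn g a b) : IsTranspOn g b a := by
  obtain ⟨hab, hga, hgb, hfix⟩ := hg
  exact ⟨hab.symm, hgb, hga, fun x hxb hxa => hfix x hxa hxb⟩

/-- Rotating a 3-cycle. -/
theorem IsThreeCycleOn.rotate {g : Perm α} {a b c : α} (hg : IsThreeCycleOn g a b c) :
    IsThreeCycleOn g b c a := by
  obtain ⟨hab, hac, hbc, hga, hgb, hgc, hfix⟩ := hg
  exact ⟨hbc, hab.symm, hac.symm, hgb, hgc, hga, fun x hxb hxc hxa => hfix x hxa hxb hxc⟩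

/-- Relabelling a double transposition inside its first pair. -/
theorem IsDoubleTranspOn.swap_first {g : Perm α} {a b c d : α} (hg : IsDoubleTranspOn g a b c d) :
    IsDoubleTranspOn g b a c d := by
  obtain ⟨hab, hac, had, hbc, hbd, hcd, hga, hgb, hgc, hgd, hfix⟩ := hg
  exact ⟨hab.symm, hbc, hbd, hac, had, hcd, hgb, hga, hgc, hgd,
    fun x hxb hxa hxc hxd => hfix x hxa hxb hxc hxd⟩

/-- Relabelling a double transposition by exchanging its two pairs. -/
theorem IsDoubleTranspOn.swap_pairs {g : Perm α} {a b c d : α} (hg : IsDoubleTranspOn g a b c d) :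
    IsDoubleTranspOn g c d a b := by
  obtain ⟨hab, hac, had, hbc, hbd, hcd, hga, hgb, hgc, hgd, hfix⟩ := hg
  exact ⟨hcd, hac.symm, hbc.symm, had.symm, hbd.symm, hab, hgc, hgd, hga, hgb,
    fun x hxc hxd hxa hxb => hfix x hxa hxb hxc hxd⟩

/-- PAIRING THEOREM (group-theoretic core). Let the transitive group generated by `S` preserve a
non-total equivalence relation `r` with a non-singleton class, every generator being the identity,
a transposition, a 3-cycle or a double transposition. Then some generator is a double
transposition `(a b)(c d)` moving the class of `a`, and that class is the pair `{a, c}` or `{a, d}`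
(in particular blocks have size two). -/
theorem pairing {r : α → α → Prop} (hr : Equivalence r) {S : Set (Perm α)}
    (hgen : ∀ s ∈ S, s = 1 ∨ (∃ a b, IsTranspOn s a b) ∨ (∃ a b c, IsThreeCycleOn s a b c) ∨
      (∃ a b c d, IsDoubleTranspOn s a b c d))
    (hinv : ∀ s ∈ S, ∀ x y, r (s x) (s y) ↔ r x y)
    (htrans : ∀ x y : α, ∃ h ∈ Subgroup.closure S, h x = y)
    (hns : ∃ x y : α, x ≠ y ∧ r x y) (hnt : ∃ x y : α, ¬ r x y) :
    ∃ s ∈ S, ∃ a b c d : α, IsDoubleTranspOn s a b c d ∧ ¬ r a b ∧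
      ((∀ x, r a x → x = a ∨ x = c) ∨ (∀ x, r a x → x = a ∨ x = d)) := by
  -- every class is a non-singleton (transport the given related pair by transitivity)
  have hns' : ∀ a : α, ∃ x, x ≠ a ∧ r a x := by
    intro a
    obtain ⟨x₀, y₀, hne, hrel⟩ := hns
    obtain ⟨h, hh, hx⟩ := htrans x₀ a
    refine ⟨h y₀, ?_, ?_⟩
    · intro heq
      apply hne
      apply h.injective
      rw [hx, heq]
    · have := (closure_preserves hinv hh x₀ y₀).2 hrel
      rw [hx] at this
      exact this
  -- some generator moves some point out of its class
  have hmov : ∃ s ∈ S, ∃ x, ¬ r x (s x) := by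
    by_contra hcon
    simp only [not_exists, not_and, not_not] at hcon
    obtain ⟨x, y, hxy⟩ := hnt
    exact hxy (rel_all_of_generators_keep_class hr hcon htrans x y)
  obtain ⟨s, hs, x, hx⟩ := hmov
  have hinv_s := hinv s hs
  rcases hgen s hs with h1 | ⟨a, b, hab⟩ | ⟨a, b, c, habc⟩ | ⟨a, b, c, d, habcd⟩
  · -- identity: impossible
    rw [h1] at hx
    exact (hx (by simpa using hr.refl x)).elim
  · -- transposition: impossible by (L1)
    exfalso
    have h0 := hab
    obtain ⟨_, hga, hgb, hfix⟩ := hab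
    by_cases hxa : x = a
    · rw [hxa, hga] at hx
      exact hx (transp_keeps_class hr h0 hinv_s (hns' a))
    by_cases hxb : x = b
    · rw [hxb, hgb] at hx
      exact hx (transp_keeps_class hr h0.swap_args hinv_s (hns' b))
    · rw [hfix x hxa hxb] at hx
      exact hx (hr.refl x)
  · -- 3-cycle: impossible by (L2)
    exfalso
    have h0 := habc
    obtain ⟨_, _, _, hga, hgb, hgc, hfix⟩ := habc
    by_cases hxa : x = a
    · rw [hxa, hga] at hx
      exact hx (threeCycle_keeps_class hr h0 hinv_s (hns' a))
    by_cases hxb : x = b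
    · rw [hxb, hgb] at hx
      exact hx (threeCycle_keeps_class hr h0.rotate hinv_s (hns' b))
    by_cases hxc : x = c
    · rw [hxc, hgc] at hx
      exact hx (threeCycle_keeps_class hr h0.rotate.rotate hinv_s (hns' c))
    · rw [hfix x hxa hxb hxc] at hx
      exact hx (hr.refl x)
  · -- double transposition: the moved class is a pair by (L3′)
    have h0 := habcd
    obtain ⟨_, _, _, _, _, _, hga, hgb, hgc, hgd, hfix⟩ := habcd
    by_cases hxa : x = a
    · rw [hxa, hga] at hx
      exact ⟨s, hs, a, b, c, d, h0, hx, doubleTransp_class_pair hr h0 hinv_s hx⟩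
    by_cases hxb : x = b
    · rw [hxb, hgb] at hx
      exact ⟨s, hs, b, a, c, d, h0.swap_first, hx,
        doubleTransp_class_pair hr h0.swap_first hinv_s hx⟩
    by_cases hxc : x = c
    · rw [hxc, hgc] at hx
      exact ⟨s, hs, c, d, a, b, h0.swap_pairs, hx,
        doubleTransp_class_pair hr h0.swap_pairs hinv_s hx⟩
    by_cases hxd : x = d
    · rw [hxd, hgd] at hx
      exact ⟨s, hs, d, c, a, b, h0.swap_pairs.swap_first, hx,
        doubleTransp_class_pair hr h0.swap_pairs.swap_first hinv_s hx⟩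
    · rw [hfix x hxa hxb hxc hxd] at hx
      exact (hx (hr.refl x)).elim

end Summit.HodgeConjecture.HodgeConjecture.Theorems.Pairing
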